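import Summits.ResolutionOfSingularities.ResolutionOfSingularities.Theorems.FrobeniusLadderFInjectiveMacaulayficationPointFixableTowerCons
import Summits.ResolutionOfSingularities.ResolutionOfSingularities.Theorems.FrobeniusLadderFInjectiveMacaulayficationCertifiedChartCentre
import Summits.ResolutionOfSingularities.ResolutionOfSingularities.Theorems.FrobeniusLadderFInjectiveMacaulayficationCICertificates
import Summits.ResolutionOfSingularities.ResolutionOfSingularities.Theorems.FrobeniusLadderFInjectiveMacaulayficationClauseOfMaximal
import Summits.ResolutionOfSingularities.ResolutionOfSingularities.Theorems.FrobeniusLadderFInjectiveMacaulayficationReesChartRing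
import Literature.AlgebraicGeometry.Resolution.AffineBlowupUnique
import HarnessLib

/-!
# `PFix` from a certificate block — the hoff-free Spec-specimen adapter of road B
# (crux `FInjectiveMacaulayfication`, T-𝒫-loc / road B «K-loc-Lean»)

[OURS · L1 W4.5a · res-L1-w45a-stub-3] Support file (`--supports stmt-ResolutionOfSingularities-15315 --as helper`) for the crux
`FrobeniusLadder.FInjectiveMacaulayfication`; NOT a statement of any manuscript; AI-written, weaker than expert review.

Road B (rulings R12.11/R12.12, `L/w45a/ToricCertSig.lean` v1 ab1a5003a935443d) wants, from a K-loc certificate of a specimen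
`X = Spec (k[X]/(Fs))`, the ring-local verdict `PFix (𝒪_{X,0})` (ClassGlueSig v3 74b6a04e74c75940 §5 = the currency of the
residual target 5e) WITHOUT any «clause off the origin» input. The planner's proposed adapter `G1 ∘ 5d` does not deliver that
(5d `CertifiedChartPointFixable.certifiedChart_pointFixable` consumes the admissible package and `P_cert`'s alone-bad conjunct).
This file gives the hoff-free route (objection 2, HOME/STATUS 2026-08-27T08:4xZ):

* `affineBlowup_fiClause_over_of_cert` — **E6‴ OVER THE CENTRE ONLY**: `R` a Noetherian domain of characteristic `p`, the E6‴
  certificate block for `(I, v)` (cover inequality, `v_j ≠ 0`, chart clause at the maximal ideals containing `v_j/1` of the affine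
  blow-up algebras) and NO hypothesis off `V(I)` ⟹ the full clause at every stalk of `affineBlowup I` at a point `y` lying over
  `V(I)` (`I ≤ 𝔭_{π y}`): `y` lies in a vertex chart `D₊(v_j t)` (`exists_mem_basicOpen_of_irrelevant_le_radical`), at a prime `q`
  of the chart ring with `q ∩ R = 𝔭_{π y} ⊇ I ∋ v_j` (`affineBlowup.chartι_π`), so `v_j/1 ∈ q ⊆ Q` for a maximal `Q` where the
  clause is certified (`chartClause_of_blowupAlgebraClause`); it descends to `q` (`ClauseOfMaximal.fiClause_atPrime_of_le`) and
  moves to the stalk (`Spec.stalkIso`, stalk maps of open immersions).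
* `pointFixable_of_cert` — **CERT ⇒ PFix**: with `𝔪` maximal, `V(I) = {𝔪}` («`I ≤ P ↔ 𝔪 ≤ P`») and `I ≠ 0`:
  `PFix ((Spec R).presheaf.stalk 𝔪)` VERBATIM, by the one-shot tower lemma `PointFixableTowerCons.pointFixable_of_goodBlowup`
  (p514141) applied to `affineBlowup.π I` (`affineBlowup.isBlowup`, `affineBlowup.support_idealSheaf`).
* `pointFixable_of_ciCert` — the road-B Lean target's consumer: the binder block of `CICertificates.ciCertificates` (p507818) +
  `hAJ` + point support `hJ` + «the origin lies on `X`» ⟹ `PFix` at the origin of `Spec (k[X]/(Fs))`. ZERO hoff, zero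
  admissibility, zero named facts.
-/

-- single-problem summit: the doubled namespace component is forced
set_option linter.dupNamespace false

noncomputable section

namespace Summit.ResolutionOfSingularities.ResolutionOfSingularities.Theorems.FInjectiveMacaulayfication.PointFixableOfCert

open AlgebraicGeometry CategoryTheory CategoryTheory.Limits Literature.AlgebraicGeometry.Resolution TopologicalSpace IsLocalRing
open MvPolynomial
open Summit.ResolutionOfSingularities.ResolutionOfSingularities.Theorems.FInjectiveMacaulayfication

set_option maxHeartbeats 800000 in
-- chart-ring instance unification is slow
/-- **E6‴ OVER THE CENTRE ONLY (hoff-free).** Under the E6‴ certificate block for `(I, v)` on a Noetherian domain `R` of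
characteristic `p`, every stalk of `affineBlowup I` at a point over `V(I)` is a domain, Cohen–Macaulay, with every parameter ideal
Frobenius closed. [cite: StacksProject, Tag 0804] -/
theorem affineBlowup_fiClause_over_of_cert (p : ℕ) [Fact p.Prime] (R : Type) [CommRing R] [IsDomain R] [IsNoetherianRing R]
    [CharP R p] (I : Ideal R) (t : ℕ) (v : Fin t → R) (hv : ∀ j : Fin t, v j ∈ I)
    (hcov : (HomogeneousIdeal.irrelevant (reesGrading I)).toIdeal ≤
      (Ideal.span (Set.range fun j : Fin t => reesT (I := I) (v j) (hv j))).radical)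
    (hv0 : ∀ j : Fin t, v j ≠ 0)
    (hon : ∀ (j : Fin t) (Q : Ideal (Literature.AlgebraicGeometry.Resolution.blowupAlgebra I (v j))) [Q.IsMaximal],
      algebraMap R (Literature.AlgebraicGeometry.Resolution.blowupAlgebra I (v j)) (v j) ∈ Q →
      ∀ d : ℕ, ringKrullDim (Localization.AtPrime Q) = d → ∀ s : Fin d → Localization.AtPrime Q, (Ideal.span (Set.range s)).radical.IsMaximal → RingTheory.Sequence.IsWeaklyRegular (Localization.AtPrime Q) (List.ofFn s) ∧ ∀ y : Localization.AtPrime Q, (∃ e : ℕ, y ^ p ^ e ∈ Ideal.span ((fun z : Localization.AtPrime Q => z ^ p ^ e) '' (Ideal.span (Set.range s) : Set (Localization.AtPrime Q)))) → y ∈ Ideal.span (Set.range s))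
    (y : ↥(affineBlowup I)) (hy : I ≤ ((affineBlowup.π I).base y).asIdeal) :
    IsDomain ((affineBlowup I).presheaf.stalk y) ∧ ∀ d : ℕ, ringKrullDim ((affineBlowup I).presheaf.stalk y) = d → ∀ s : Fin d → (affineBlowup I).presheaf.stalk y, (Ideal.span (Set.range s)).radical.IsMaximal → RingTheory.Sequence.IsWeaklyRegular ((affineBlowup I).presheaf.stalk y) (List.ofFn s) ∧ ∀ u : (affineBlowup I).presheaf.stalk y, (∃ e : ℕ, u ^ p ^ e ∈ Ideal.span ((fun z : (affineBlowup I).presheaf.stalk y => z ^ p ^ e) '' (Ideal.span (Set.range s) : Set ((affineBlowup I).presheaf.stalk y)))) → u ∈ Ideal.span (Set.range s) := by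
  classical
  -- `y` lies in a vertex chart `D₊(v_j t)`, at a prime `q` of the chart ring
  obtain ⟨j, hj⟩ := BlowupFiModelOfCover.exists_mem_basicOpen_of_irrelevant_le_radical v hv hcov y
  rw [← Proj.opensRange_awayι (reesGrading I) (reesT (v j) (hv j)) (reesT_mem (v j) (hv j)) Nat.one_pos] at hj
  obtain ⟨q, hq⟩ := Scheme.Hom.mem_opensRange.mp hj
  have hι : Proj.awayι (reesGrading I) (reesT (v j) (hv j)) (reesT_mem (v j) (hv j)) Nat.one_pos =
      affineBlowup.chartι (I := I) (v j) (hv j) := rfl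
  -- `q ∩ R = 𝔭_(π y) ⊇ I`, hence `v_j/1 ∈ q`
  have hπq : ((affineBlowup.π I).base y).asIdeal = q.asIdeal.comap (reesChartBase (I := I) (v j) (hv j)) := by
    rw [← hq, hι, ← Scheme.Hom.comp_apply, affineBlowup.chartι_π (v j) (hv j), Spec.map_apply]
    rfl
  have hmem : reesChartBase (I := I) (v j) (hv j) (v j) ∈ q.asIdeal := by
    have h1 : v j ∈ ((affineBlowup.π I).base y).asIdeal := hy (hv j)
    rw [hπq, Ideal.mem_comap] at h1
    exact h1
  -- the chart ring is a Noetherian domain of characteristic `p`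
  obtain ⟨hnoeth, hdom, hchar⟩ := ReesChartRing.stub_reesChartRing p R I (v j) (hv j) (hv0 j)
  haveI := hnoeth; haveI := hdom; haveI := hchar
  -- a maximal `Q ⊇ q` carries the certified clause; it descends to `q`
  obtain ⟨Q, hQmax, hqQ⟩ := Ideal.exists_le_maximal q.asIdeal q.isPrime.ne_top
  have hQcl := BlowupFiModelOfCover.chartClause_of_blowupAlgebraClause p (v j) (hv j) (hon j) Q (hqQ hmem)
  have hqcl := ClauseOfMaximal.fiClause_atPrime_of_le p hqQ ⟨inferInstance, hQcl⟩
  -- move to the stalk: `𝒪_(Bl, y) ≅ 𝒪_(Spec B, q) ≅ B_q`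
  subst hq
  let e : ((affineBlowup I).presheaf.stalk
      ((Proj.awayι (reesGrading I) (reesT (v j) (hv j)) (reesT_mem (v j) (hv j)) Nat.one_pos) q)) ≃+*
      Localization.AtPrime q.asIdeal :=
    (asIso ((Proj.awayι (reesGrading I) (reesT (v j) (hv j)) (reesT_mem (v j) (hv j))
      Nat.one_pos).stalkMap q)).commRingCatIsoToRingEquiv.trans
      (Spec.stalkIso (.of (HomogeneousLocalization.Away (reesGrading I) (reesT (v j) (hv j)))) q).commRingCatIsoToRingEquiv
  exact fiClause_of_ringEquiv p e.symm hqcl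

set_option maxHeartbeats 800000 in
-- the ∃-packaged clause elaborates large terms
/-- **CERT ⇒ PFix (hoff-free).** `R` a Noetherian domain of characteristic `p`, `𝔪` a maximal ideal, `I ≠ 0` with `V(I) = {𝔪}`
(«`I ≤ P ↔ 𝔪 ≤ P`» for primes `P`) carrying the E6‴ certificate block ⟹ `PFix` of the local ring of `Spec R` at `𝔪`
(ClassGlueSig v3 §5 text, verbatim): `affineBlowup.π I` is a point-supported blowing up along `Ĩ` (`affineBlowup.isBlowup`,
`affineBlowup.support_idealSheaf`) good over `𝔪` by `affineBlowup_fiClause_over_of_cert`; conclude by the one-shot tower lemma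
`PointFixableTowerCons.pointFixable_of_goodBlowup`. [folklore] -/
theorem pointFixable_of_cert (p : ℕ) [Fact p.Prime] (R : Type) [CommRing R] [IsDomain R] [IsNoetherianRing R] [CharP R p]
    (I 𝔪 : Ideal R) [h𝔪 : 𝔪.IsMaximal] (hI : I ≠ ⊥) (hzero : ∀ P : Ideal R, P.IsPrime → (I ≤ P ↔ 𝔪 ≤ P))
    (hcert : ∃ (t : ℕ) (v : Fin t → R) (hv : ∀ j : Fin t, v j ∈ I),
        (HomogeneousIdeal.irrelevant (reesGrading (I))).toIdeal ≤ (Ideal.span (Set.range fun j : Fin t => reesT (I := I) (v j) (hv j))).radical ∧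
        (∀ j : Fin t, v j ≠ 0) ∧
        ∀ (j : Fin t) (Q : Ideal (Literature.AlgebraicGeometry.Resolution.blowupAlgebra (I) (v j))) [Q.IsMaximal],
          algebraMap R (Literature.AlgebraicGeometry.Resolution.blowupAlgebra (I) (v j)) (v j) ∈ Q →
          ∀ d : ℕ, ringKrullDim (Localization.AtPrime Q) = d → ∀ s : Fin d → Localization.AtPrime Q, (Ideal.span (Set.range s)).radical.IsMaximal → RingTheory.Sequence.IsWeaklyRegular (Localization.AtPrime Q) (List.ofFn s) ∧ ∀ y : Localization.AtPrime Q, (∃ e : ℕ, y ^ p ^ e ∈ Ideal.span ((fun z : Localization.AtPrime Q => z ^ p ^ e) '' (Ideal.span (Set.range s) : Set (Localization.AtPrime Q)))) → y ∈ Ideal.span (Set.range s)) :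
    (∃ (n : ℕ) (c : Fin n → (Spec (.of R)).presheaf.stalk (⟨𝔪, h𝔪.isPrime⟩ : PrimeSpectrum R)), Ideal.span (Set.range c) ≠ ⊥ ∧ (Ideal.span (Set.range c)).radical = IsLocalRing.maximalIdeal ((Spec (.of R)).presheaf.stalk (⟨𝔪, h𝔪.isPrime⟩ : PrimeSpectrum R)) ∧
        ∀ (j : Fin n) (𝔔 : PrimeSpectrum (Literature.AlgebraicGeometry.Resolution.blowupAlgebra (Ideal.span (Set.range c)) (c j))),
          𝔔.asIdeal.comap (algebraMap ((Spec (.of R)).presheaf.stalk (⟨𝔪, h𝔪.isPrime⟩ : PrimeSpectrum R)) (Literature.AlgebraicGeometry.Resolution.blowupAlgebra (Ideal.span (Set.range c)) (c j))) = IsLocalRing.maximalIdeal ((Spec (.of R)).presheaf.stalk (⟨𝔪, h𝔪.isPrime⟩ : PrimeSpectrum R)) →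
          IsDomain (Localization.AtPrime 𝔔.asIdeal) ∧ ∀ d : ℕ, ringKrullDim (Localization.AtPrime 𝔔.asIdeal) = d → ∀ s : Fin d → Localization.AtPrime 𝔔.asIdeal, (Ideal.span (Set.range s)).radical.IsMaximal → RingTheory.Sequence.IsWeaklyRegular (Localization.AtPrime 𝔔.asIdeal) (List.ofFn s) ∧ ∀ y : Localization.AtPrime 𝔔.asIdeal, (∃ e : ℕ, y ^ p ^ e ∈ Ideal.span ((fun z : Localization.AtPrime 𝔔.asIdeal => z ^ p ^ e) '' (Ideal.span (Set.range s) : Set (Localization.AtPrime 𝔔.asIdeal)))) → y ∈ Ideal.span (Set.range s)) := by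
  classical
  obtain ⟨t, v, hv, hcov, hv0, hon⟩ := hcert
  -- the point and its closedness
  have hb : IsClosed ({(⟨𝔪, h𝔪.isPrime⟩ : PrimeSpectrum R)} : Set (PrimeSpectrum R)) :=
    (PrimeSpectrum.isClosed_singleton_iff_isMaximal _).mpr h𝔪
  -- the centre `Ĩ`: finite type, non-zero, supported at `𝔪`
  have hfg : ∀ U : (Spec (.of R)).affineOpens, ((affineBlowup.idealSheaf I).ideal U).FG := fun U => by
    haveI : IsNoetherianRing Γ(Spec (.of R), U) := IsLocallyNoetherian.component_noetherian U
    exact IsNoetherian.noetherian _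
  have hne : affineBlowup.idealSheaf I ≠ ⊥ := by
    intro h0
    have h1 := Literature.AlgebraicGeometry.Resolution.ideal_ofIdealTop_top (X := Spec (.of R))
      (I.map (Scheme.ΓSpecIso (.of R)).inv.hom)
    change (affineBlowup.idealSheaf I).ideal _ = _ at h1
    rw [h0, Scheme.IdealSheafData.ideal_bot, Pi.bot_apply] at h1
    apply hI
    have h2 : I.map (Scheme.ΓSpecIso (.of R)).inv.hom = ⊥ := h1.symm
    have hinj : Function.Injective (Scheme.ΓSpecIso (.of R)).inv.hom := by
      intro a₁ a₂ h12
      have h3 := congrArg (Scheme.ΓSpecIso (.of R)).hom.hom h12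
      simpa using h3
    exact (Ideal.map_eq_bot_iff_of_injective hinj).mp h2
  have hsupp : ((affineBlowup.idealSheaf I).support : Set (Spec (.of R))) = {(⟨𝔪, h𝔪.isPrime⟩ : PrimeSpectrum R)} := by
    rw [affineBlowup.support_idealSheaf]
    apply Set.Subset.antisymm
    · intro P hP
      rw [PrimeSpectrum.mem_zeroLocus, SetLike.coe_subset_coe, hzero P.asIdeal P.isPrime] at hP
      exact Set.mem_singleton_iff.mpr (PrimeSpectrum.ext (h𝔪.eq_of_le P.isPrime.ne_top hP).symm)
    · intro P hP
      have hP' : P = ⟨𝔪, h𝔪.isPrime⟩ := Set.mem_singleton_iff.mp hP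
      subst hP'
      rw [PrimeSpectrum.mem_zeroLocus, SetLike.coe_subset_coe]
      exact (hzero 𝔪 h𝔪.isPrime).mpr le_rfl
  refine PointFixableTowerCons.pointFixable_of_goodBlowup p (Spec (.of R)) (⟨𝔪, h𝔪.isPrime⟩ : PrimeSpectrum R) hb
    (affineBlowup.idealSheaf I) hfg hne hsupp (affineBlowup I) (affineBlowup.π I) (affineBlowup.isBlowup I) ?_
  intro x' hx'
  refine affineBlowup_fiClause_over_of_cert p R I t v hv hcov hv0 hon x' ?_
  rw [hx']
  exact (hzero 𝔪 h𝔪.isPrime).mpr le_rfl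

set_option maxHeartbeats 800000 in
-- large binder block
/-- **ROAD B's CONSUMER — `PFix` AT THE ORIGIN OF A CI SPECIMEN FROM ITS CERTIFICATE DATA.** The binder block of
`CICertificates.ciCertificates` (monomial centre `I_A`, unimodular charts, vertices, strict transforms, naive-quotient chart clause
`hon'`, `hv`), `hAJ`, `0 < t`, the point-support binder `hJ`, and «the origin lies on `X`» (`(x̄₁, …, x̄ₙ)` maximal) ⟹
`PFix (𝒪_{Spec (k[X]/(Fs)), 0})`. NO clause off the origin, NO admissibility, NO named fact. [folklore] -/
theorem pointFixable_of_ciCert (p : ℕ) [Fact p.Prime] (k : Type) [Field k] [CharP k p] :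
    ∀ (n : ℕ) (J : Finset (Fin n))
    (A : Finset (Fin n →₀ ℕ)), (∀ j ∈ J, ∃ N : ℕ, Finsupp.single j N ∈ A) →
    (∀ a ∈ A, ∃ j ∈ J, 0 < a j) →
    ∀ (t : ℕ), 0 < t → ∀ (m : Fin t → (Fin n →₀ ℕ)),
    (∀ a ∈ A, ∃ (c : Fin t) (K : ℕ), 1 ≤ K ∧ ∃ y ∈ (Ideal.span ((fun b : Fin n →₀ ℕ => (MvPolynomial.monomial b (1 : k) : MvPolynomial (Fin n) k)) '' (A : Set (Fin n →₀ ℕ)))) ^ (K - 1),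
      (MvPolynomial.monomial a (1 : k) : MvPolynomial (Fin n) k) ^ K = MvPolynomial.monomial (m c) 1 * y) →
    ∀ (V : Fin t → Matrix (Fin n) (Fin n) ℕ), (∀ c, IsUnit ((V c).map (Nat.cast : ℕ → ℤ)).det) →
    ∀ (a : Fin t → Fin n → (Fin n →₀ ℕ)), (∀ c i, a c i ∈ A) →
    (∀ (c : Fin t) (i : Fin n), (Finsupp.equivFunOnFinite.symm ((V c).mulVec ⇑(a c i)) : Fin n →₀ ℕ) =
      Finsupp.equivFunOnFinite.symm ((V c).mulVec ⇑(m c)) + Finsupp.single i 1) →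
    (∀ (c : Fin t), ∀ e ∈ A, (Finsupp.equivFunOnFinite.symm ((V c).mulVec ⇑(m c)) : Fin n →₀ ℕ) ≤
      Finsupp.equivFunOnFinite.symm ((V c).mulVec ⇑e)) →
    ∀ (r : ℕ) (Fs : Fin r → MvPolynomial (Fin n) k), (Ideal.span (Set.range Fs)).IsPrime →
    (∀ v : Fin n, Ideal.Quotient.mk (Ideal.span (Set.range Fs)) (MvPolynomial.X v) ≠ 0) →
    ∀ (gs : Fin t → Fin r → MvPolynomial (Fin n) k) (d : Fin t → Fin r → (Fin n →₀ ℕ)),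
    (∀ (c : Fin t) (l : Fin r), aeval (fun j : Fin n => ∏ i : Fin n, (X i : MvPolynomial (Fin n) k) ^ V c i j) (Fs l) =
      monomial (d c l) (1 : k) * gs c l) →
    (∀ (c : Fin t) (l : Fin r), ∃ (N : ℕ) (r' : Fin n →₀ ℕ), N • m c = ∑ j : Fin n, d c l j • a c j + r') →
    (∀ (c : Fin t) (Q' : Ideal (MvPolynomial (Fin n) k ⧸ Ideal.span (Set.range (gs c)))) [Q'.IsMaximal],
      (∀ j ∈ J, Ideal.Quotient.mk (Ideal.span (Set.range (gs c)))
        (aeval (fun j : Fin n => ∏ i : Fin n, (X i : MvPolynomial (Fin n) k) ^ V c i j) (X j : MvPolynomial (Fin n) k)) ∈ Q') →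
        (∀ i : Fin n, (X i : MvPolynomial (Fin n) k) ∈ Q'.comap (Ideal.Quotient.mk (Ideal.span (Set.range (gs c)))) →
          IsSMulRegular (Localization.AtPrime (Q'.comap (Ideal.Quotient.mk (Ideal.span (Set.range (gs c))))) ⧸
              (Ideal.span (Set.range (gs c))).map (algebraMap (MvPolynomial (Fin n) k)
                (Localization.AtPrime (Q'.comap (Ideal.Quotient.mk (Ideal.span (Set.range (gs c))))))))
            (algebraMap (MvPolynomial (Fin n) k)
              (Localization.AtPrime (Q'.comap (Ideal.Quotient.mk (Ideal.span (Set.range (gs c)))))) (X i))) ∧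
        ∀ dd : ℕ, ringKrullDim (Localization.AtPrime Q') = dd → ∀ s : Fin dd → Localization.AtPrime Q',
          (Ideal.span (Set.range s)).radical.IsMaximal →
            RingTheory.Sequence.IsWeaklyRegular (Localization.AtPrime Q') (List.ofFn s) ∧
            ∀ y : Localization.AtPrime Q', (∃ e : ℕ, y ^ p ^ e ∈ Ideal.span
              ((fun z : Localization.AtPrime Q' => z ^ p ^ e) ''
                (Ideal.span (Set.range s) : Set (Localization.AtPrime Q')))) → y ∈ Ideal.span (Set.range s)) →
    (∀ c : Fin t, Ideal.Quotient.mk (Ideal.span (Set.range Fs)) (monomial (m c) (1 : k)) ∈ (Ideal.span ((fun e : Fin n →₀ ℕ => Ideal.Quotient.mk (Ideal.span (Set.range Fs)) (monomial e (1 : k))) '' (A : Set (Fin n →₀ ℕ))))) →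
    (∀ (P : Ideal (MvPolynomial (Fin n) k ⧸ Ideal.span (Set.range Fs))) [P.IsPrime],
      (∀ j ∈ J, Ideal.Quotient.mk (Ideal.span (Set.range Fs)) (MvPolynomial.X j) ∈ P) → ∀ i : Fin n, Ideal.Quotient.mk (Ideal.span (Set.range Fs)) (MvPolynomial.X i) ∈ P) →
    ∀ (h𝔪 : (Ideal.span (Set.range fun i : Fin n => Ideal.Quotient.mk (Ideal.span (Set.range Fs)) (MvPolynomial.X i))).IsMaximal),
    (∃ (nc : ℕ) (c : Fin nc → (Spec (.of (MvPolynomial (Fin n) k ⧸ Ideal.span (Set.range Fs)))).presheaf.stalk (⟨Ideal.span (Set.range fun i : Fin n => Ideal.Quotient.mk (Ideal.span (Set.range Fs)) (MvPolynomial.X i)), h𝔪.isPrime⟩ : PrimeSpectrum (MvPolynomial (Fin n) k ⧸ Ideal.span (Set.range Fs)))), Ideal.span (Set.range c) ≠ ⊥ ∧ (Ideal.span (Set.range c)).radical = IsLocalRing.maximalIdeal ((Spec (.of (MvPolynomial (Fin n) k ⧸ Ideal.span (Set.range Fs)))).presheaf.stalk (⟨Ideal.span (Set.range fun i : Fin n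 => Ideal.Quotient.mk (Ideal.span (Set.range Fs)) (MvPolynomial.X i)), h𝔪.isPrime⟩ : PrimeSpectrum (MvPolynomial (Fin n) k ⧸ Ideal.span (Set.range Fs)))) ∧
        ∀ (j : Fin nc) (𝔔 : PrimeSpectrum (Literature.AlgebraicGeometry.Resolution.blowupAlgebra (Ideal.span (Set.range c)) (c j))),
          𝔔.asIdeal.comap (algebraMap ((Spec (.of (MvPolynomial (Fin n) k ⧸ Ideal.span (Set.range Fs)))).presheaf.stalk (⟨Ideal.span (Set.range fun i : Fin n => Ideal.Quotient.mk (Ideal.span (Set.range Fs)) (MvPolynomial.X i)), h𝔪.isPrime⟩ : PrimeSpectrum (MvPolynomial (Fin n) k ⧸ Ideal.span (Set.range Fs)))) (Literature.AlgebraicGeometry.Resolution.blowupAlgebra (Ideal.span (Set.range c)) (c j))) = IsLocalRing.maximalIdeal ((Spec (.of (MvPolynomial (Fin n) k ⧸ Ideal.span (Set.range Fs)))).presheaf.stalk (⟨Ideal.span (Set.range fun i : Fin n => Ideal.Quotient.mk (Ideal.span (Set.range Fs)) (MvPolynomial.X i)), h𝔪.isPrime⟩ : PrimeSpectrum (MvPolynomial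 (Fin n) k ⧸ Ideal.span (Set.range Fs)))) →
          IsDomain (Localization.AtPrime 𝔔.asIdeal) ∧ ∀ d : ℕ, ringKrullDim (Localization.AtPrime 𝔔.asIdeal) = d → ∀ s : Fin d → Localization.AtPrime 𝔔.asIdeal, (Ideal.span (Set.range s)).radical.IsMaximal → RingTheory.Sequence.IsWeaklyRegular (Localization.AtPrime 𝔔.asIdeal) (List.ofFn s) ∧ ∀ y : Localization.AtPrime 𝔔.asIdeal, (∃ e : ℕ, y ^ p ^ e ∈ Ideal.span ((fun z : Localization.AtPrime 𝔔.asIdeal => z ^ p ^ e) '' (Ideal.span (Set.range s) : Set (Localization.AtPrime 𝔔.asIdeal)))) → y ∈ Ideal.span (Set.range s)) := by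
  intro n J A hprim hAJ t ht m hcov V hV a haA hgen hge r Fs hprime hXne gs d hθF hunit hon' hv hJ h𝔪
  classical
  haveI := hprime
  haveI : IsDomain (MvPolynomial (Fin n) k ⧸ Ideal.span (Set.range Fs)) := Ideal.Quotient.isDomain _
  haveI : CharP (MvPolynomial (Fin n) k ⧸ Ideal.span (Set.range Fs)) p :=
    charP_of_injective_algebraMap (algebraMap k (MvPolynomial (Fin n) k ⧸ Ideal.span (Set.range Fs))).injective p
  have H :=
    CICertificates.ciCertificates p k J A hprim t m hcov V hV a haA hgen hge Fs hprime hXne gs d hθF hunit hon' hv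
  have hI : Ideal.span ((fun e : Fin n →₀ ℕ => Ideal.Quotient.mk (Ideal.span (Set.range Fs)) (monomial e (1 : k))) '' (A : Set (Fin n →₀ ℕ))) ≠ ⊥ := by
    intro h0
    apply H.2.1 ⟨0, ht⟩
    have hmem := hv ⟨0, ht⟩
    rw [h0] at hmem
    exact (Submodule.mem_bot _).mp hmem
  refine pointFixable_of_cert p (MvPolynomial (Fin n) k ⧸ Ideal.span (Set.range Fs)) _ (Ideal.span (Set.range fun i : Fin n => Ideal.Quotient.mk (Ideal.span (Set.range Fs)) (MvPolynomial.X i))) hI (fun P hP => ?_) ⟨t, _, hv, H.1, H.2.1, H.2.2⟩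
  haveI := hP
  rw [CICertificates.centre_le_iff _ J A hAJ hprim P]
  constructor
  · intro hX
    rw [Ideal.span_le, Set.range_subset_iff]
    exact hJ P hX
  · intro hm j _
    exact hm (Ideal.subset_span ⟨j, rfl⟩)

end Summit.ResolutionOfSingularities.ResolutionOfSingularities.Theorems.FInjectiveMacaulayfication.PointFixableOfCert

end
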